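import Mathlib
import Summits.Ventures.HodgeRepro.CMRank
import Summits.Ventures.HodgeRepro.OcticCMPointWitness

/-!
# OcticCMPointRank — both factors of the octic CM point are nondegenerate (rank `5`) on the kernel

Blind re-derivation cell `pub-hodge-repro`, seat night-2 (gen 0).  Target tree path
`lean/Summits/Ventures/HodgeRepro/OcticCMPointRank.lean`.  Continues `OcticCMPointWitness.lean`.

ROUTE-B §9.32 (a): the two CM types `Φ`, `σΦ` of `E = ℚ(ζ₅, √(4+√5))` have rank `5` («rank = ℚ-rank of the span of
the Galois translates of Φ (nondegenerate = 5 = dim + 1)»), so `A_Φ` and `A_{σΦ}` are simple nondegenerate CM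
fourfolds — the point lies in the OPEN cell of S8 (`[F : ℚ] = 4`, `d = 4`, `dim 8`), not in a closed one.  The
rank is `typer`'s `cmRank` (`CMRank.lean`: the rank of the matrix of indicator vectors of the translates `gΦ`,
[Gordon] §9.1 / Kubota) transported to the `G`-set `X = Hom(E, F)` of the non-Galois field: `typeMat P` is the
`16 × 8` rational matrix `(g, x) ↦ [x ∈ gP]`, and `(typeMat Φ).rank = (typeMat (σΦ)).rank = 5` is proved with
typer's two tools — `le_rank_of_det_ne_zero` on an explicit `5 × 5` minor (its determinant is non-zero because an
explicit rational right inverse is exhibited) and `rank_le_card_of_rows_mem_span` with every one of the sixteen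
rows written as an explicit `ℤ`-combination of the five selected rows (coefficients in `{−1, 0, 1}`, checked by
`decide` on the integer matrix `typeMatZ`).

Nothing here says anything about the status of the Hodge conjecture for CM abelian varieties, which is NOT
proved.
-/

set_option autoImplicit false

namespace Summit.Ventures.HodgeRepro.OcticCMPoint

open Finset Matrix

/-- The integer type matrix of a subset `P ⊆ X` on the `G`-set `X`: row `g` is the indicator vector of the
translate `gP` (`CMRank.lean`'s `typeMatrix`, for the `G`-set `Hom(E, F)` of the non-Galois field `E`). -/
def typeMatZ (P : Finset X) : Matrix G X ℤ := fun g x => if x ∈ P.image (act g) then 1 else 0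

/-- The same matrix over `ℚ` (the rank is taken over `ℚ`, as in `CMRank.lean`). -/
def typeMat (P : Finset X) : Matrix G X ℚ := fun g x => (typeMatZ P g x : ℚ)

/-- The five columns `(1,+), (1,−), (2,+), (2,−), (3,+)` of the selected minors. -/
def colsSel : Fin 5 → X := ![(0, true), (0, false), (1, true), (1, false), (2, true)]

/-- A square matrix with a right inverse has non-zero determinant. -/
theorem det_ne_zero_of_mul_eq_one (M N : Matrix (Fin 5) (Fin 5) ℚ) (h : M * N = 1) : M.det ≠ 0 := by
  have : M.det * N.det = 1 := by rw [← Matrix.det_mul, h, Matrix.det_one]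
  exact left_ne_zero_of_mul_eq_one this

/-- The generic assembly: an explicit `5 × 5` minor with non-zero determinant and an explicit expression of
every row of the integer matrix as a combination of five selected rows give rank `5` over `ℚ`. -/
theorem rank_eq_five_of (P : Finset X) (rows : Fin 5 → G) (coef : G → Fin 5 → ℤ)
    (hdet : ((typeMat P).submatrix rows colsSel).det ≠ 0)
    (hrow : ∀ g : G, typeMatZ P g = ∑ i : Fin 5, coef g i • typeMatZ P (rows i)) :
    (typeMat P).rank = 5 := by
  refine HodgeRepro.rank_eq_of_bounds _ ?_ (HodgeRepro.le_rank_of_det_ne_zero _ rows colsSel hdet)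
  have hrowQ : ∀ g : G, typeMat P g = ∑ i : Fin 5, (coef g i : ℚ) • typeMat P (rows i) := by
    intro g
    ext x
    have h := congrFun (hrow g) x
    simp only [Finset.sum_apply, Pi.smul_apply, smul_eq_mul] at h
    simp only [typeMat, Finset.sum_apply, Pi.smul_apply, smul_eq_mul, h]
    push_cast
    rfl
  have h := HodgeRepro.rank_le_card_of_rows_mem_span (typeMat P) (fun i => typeMat P (rows i)) fun g => by
    rw [hrowQ g]
    exact Submodule.sum_mem _ fun i _ => Submodule.smul_mem _ _ (Submodule.subset_span ⟨i, rfl⟩)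
  simpa using h

/-- The rational minor is the cast of the integer minor. -/
theorem submatrix_typeMat (P : Finset X) (rows : Fin 5 → G) (M : Matrix (Fin 5) (Fin 5) ℤ)
    (h : (typeMatZ P).submatrix rows colsSel = M) :
    (typeMat P).submatrix rows colsSel = M.map (Int.cast : ℤ → ℚ) := by
  ext i j
  simp only [Matrix.submatrix_apply, typeMat, Matrix.map_apply, ← h]

/-! ### The type `Φ` -/

/-- Five Galois elements whose translates of `Φ` are linearly independent. -/
def rowsΦ : Fin 5 → G :=
  ![(0, true, true), (0, true, false), (1, true, true), (1, true, false), (2, true, true)]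

/-- The coefficients of every row of `typeMat Φ` on the five selected rows (they depend on `a` and `e₂` only:
`gΦ = g′Φ` when `g, g′` differ in `e₁` alone, since `θ ↦ −θ` preserves `Φ`). -/
def coefΦ : G → Fin 5 → ℤ := fun g =>
  match g.1, g.2.2 with
  | 0, true => ![1, 0, 0, 0, 0]
  | 0, false => ![0, 1, 0, 0, 0]
  | 1, true => ![0, 0, 1, 0, 0]
  | 1, false => ![0, 0, 0, 1, 0]
  | 2, true => ![0, 0, 0, 0, 1]
  | 2, false => ![0, 0, 1, -1, 1]
  | 3, true => ![-1, 0, 1, 0, 1]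
  | 3, false => ![0, -1, 1, 0, 1]

/-- The selected integer minor of `Φ`. -/
theorem minorZΦ : (typeMatZ Φ).submatrix rowsΦ colsSel =
    !![1, 1, 1, 0, 0; 1, 1, 0, 1, 1; 0, 1, 1, 1, 0; 1, 0, 1, 1, 0; 1, 0, 0, 0, 1] := by
  decide

/-- The selected rational minor of `Φ`, with its right inverse: determinant non-zero. -/
theorem det_minorΦ : ((typeMat Φ).submatrix rowsΦ colsSel).det ≠ 0 := by
  rw [submatrix_typeMat Φ rowsΦ _ minorZΦ]
  refine det_ne_zero_of_mul_eq_one _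
    !![(1:ℚ)/2, 1/2, -1, 1/2, -1/2; 1/2, 1/2, 0, -1/2, -1/2; 0, -1, 1, 0, 1; -1/2, 1/2, 0, 1/2, -1/2;
      -1/2, -1/2, 1, -1/2, 3/2] ?_
  ext i j
  fin_cases i <;> fin_cases j <;> simp [Matrix.mul_apply, Fin.sum_univ_succ] <;> norm_num

/-- Every row of `typeMatZ Φ` is the displayed combination of the five selected rows. -/
theorem rowΦ_eq : ∀ g : G, typeMatZ Φ g = ∑ i : Fin 5, coefΦ g i • typeMatZ Φ (rowsΦ i) := by
  decide

/-- **`Φ` has rank `5`**: `A_Φ` is a nondegenerate CM fourfold. -/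
theorem rank_phi : (typeMat Φ).rank = 5 :=
  rank_eq_five_of Φ rowsΦ coefΦ det_minorΦ rowΦ_eq

/-! ### The type `σΦ` -/

/-- Five Galois elements whose translates of `σΦ` are linearly independent. -/
def rowsσΦ : Fin 5 → G :=
  ![(0, true, true), (0, false, true), (1, true, true), (1, false, true), (2, true, true)]

/-- The coefficients of every row of `typeMat (σΦ)` on the five selected rows (they depend on `a` and `e₁`
only: `θ′ ↦ −θ′` preserves `σΦ`). -/
def coefσΦ : G → Fin 5 → ℤ := fun g =>
  match g.1, g.2.1 with
  | 0, true => ![1, 0, 0, 0, 0]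
  | 0, false => ![0, 1, 0, 0, 0]
  | 1, true => ![0, 0, 1, 0, 0]
  | 1, false => ![0, 0, 0, 1, 0]
  | 2, true => ![0, 0, 0, 0, 1]
  | 2, false => ![0, 0, 1, -1, 1]
  | 3, true => ![-1, 0, 1, 0, 1]
  | 3, false => ![0, -1, 1, 0, 1]

/-- The selected integer minor of `σΦ`. -/
theorem minorZσΦ : (typeMatZ (Φ.image (act σ))).submatrix rowsσΦ colsSel =
    !![0, 1, 1, 1, 0; 1, 0, 1, 1, 0; 0, 0, 0, 1, 1; 0, 0, 1, 0, 0; 1, 1, 1, 0, 0] := by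
  decide

/-- The selected rational minor of `σΦ`, with its right inverse: determinant non-zero. -/
theorem det_minorσΦ : ((typeMat (Φ.image (act σ))).submatrix rowsσΦ colsSel).det ≠ 0 := by
  rw [submatrix_typeMat _ rowsσΦ _ minorZσΦ]
  refine det_ne_zero_of_mul_eq_one _
    !![(-1:ℚ)/2, 1/2, 0, -1/2, 1/2; 1/2, -1/2, 0, -1/2, 1/2; 0, 0, 0, 1, 0; 1/2, 1/2, 0, -1/2, -1/2;
      -1/2, -1/2, 1, 1/2, 1/2] ?_
  ext i j
  fin_cases i <;> fin_cases j <;> simp [Matrix.mul_apply, Fin.sum_univ_succ] <;> norm_num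

/-- Every row of `typeMatZ (σΦ)` is the displayed combination of the five selected rows. -/
theorem rowσΦ_eq : ∀ g : G,
    typeMatZ (Φ.image (act σ)) g = ∑ i : Fin 5, coefσΦ g i • typeMatZ (Φ.image (act σ)) (rowsσΦ i) := by
  decide

/-- **`σΦ` has rank `5`**: `A_{σΦ}` is a nondegenerate CM fourfold. -/
theorem rank_sigma_phi : (typeMat (Φ.image (act σ))).rank = 5 :=
  rank_eq_five_of _ rowsσΦ coefσΦ det_minorσΦ rowσΦ_eq

/-- **Both factors of the octic CM point are nondegenerate** (ROUTE-B §9.32 (a): «(rank 5, simple nondegenerate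
fourfold A_Φ)», «σΦ … (rank 5 …)»). -/
theorem both_nondegenerate : (typeMat Φ).rank = 5 ∧ (typeMat (Φ.image (act σ))).rank = 5 :=
  ⟨rank_phi, rank_sigma_phi⟩

end Summit.Ventures.HodgeRepro.OcticCMPoint
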